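import Summits.Ventures.CertifiedManyBodySolver.Observables.TISourcedClusterTrialRowsTTPrime
import HarnessLib

/-!
# Cluster trial rows with an INTERVAL number row: periodic trial rows and the two-box canonical `hcap`
# when a certificate prints `⟨N⟩/(ab) ∈ [nlo, nhi]` instead of an exact density

HONEST FRAMING: first certified bounds; not a superconductivity verdict; every number certified or labelled float.
Nothing in this file is a number: it is bookkeeping that turns a cluster certificate whose particle-number row is
an INTERVAL (e.g. a DMRG/MPS state of an open box evaluated exactly but reported as outward dyadics — the W5 node
`Certificates.cert_sgf_openbox16x4_U8_mu7o4_k3o7_j260496` of sr-mbsolver-var-10, `⟨N⟩/64 ∈ [nlo, nhi]`) into the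
`hrows` / `hcap` inputs of the canonical (TI, fixed-density) chain of the CUPRATE QUESTION cell (hubbard-cq; lead
DE-DUPLICATION 2, 2026-08-26 23:10Z: «interval-density variant of `periodicTrialRows_of_clusterState`», consumer =
hubbard-cq-obsth-2's «3/14 ⊕ W5» canonical leaf).

§1 PRODUCER SIDE (`t′ = 0` and general `tp`). `hrows_of_clusterNode_interval[TT']`: an even unit cluster vector of
the open `a × b` box with energy CAP `Re⟨ψ, A_C(μ,h)ψ⟩ ≤ u·(ab)` and number row `nlo·(ab) ≤ Re⟨ψ, N_Cψ⟩ ≤ nhi·(ab)`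
(the literal conjunct order of the var-10 node) yields REAL slots `n ∈ [nlo, nhi]`, `e ≤ u` and EXACT periodic trial
rows `‖Ψ_L‖ = 1`, `Re⟨Ψ_L, NΨ_L⟩ = n·L²`, `Re⟨Ψ_L, A_L(μ,h)Ψ_L⟩ = e·L²` on every torus `q ∣ L ≥ L₀` (`a ∣ q`, `b ∣ q`,
`a, b < L₀`) — i.e. exactly the `hrows` hypothesis of `exists_isTranslationInvariant_density_eq_meanEnergy_sourced_eq_of
_periodic_trialStates` (p2) / `sourcedEnergyUpperRow_of_hrows` (obsth-3) with an unknown-but-bracketed density: the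
vector HAS an exact density, the certificate just does not print it.

§2 THE TWO-BOX CANONICAL `hcap` WITH ONE INTERVAL PARTNER (worst-end rule). p2's
`exists_canonicalClass_sourced_le_of_two_clusterCaps[TT']` mixes two periodic trial states of densities `n₁ < n₂`
bracketing `n` and needs `(n₂ − n)(u₁ + μ₁n₁) + (n − n₁)(u₂ + μ₂n₂) ≤ u(n₂ − n₁)`; this condition is AFFINE in `n₁`,
so when `n₁` is only known to lie in `[nlo, nhi]` (with `nhi ≤ n`) it suffices to check it at BOTH END POINTS
(`affine_nonpos_of_endpoints`). `exists_canonicalClass_sourced_le_of_clusterCapInterval_of_clusterCap[TT']`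
(interval box below `n`, exact box above) and `exists_canonicalClass_sourced_le_of_clusterCap_of_clusterCapInterval
[TT']` (exact box below, interval box above) return the canonical-class `hcap`
`∃ σ TI, density σ = n ∧ E^{tp, μ=0}_h(σ) ≤ u` consumed by `exists_minimiser_canonicalClass` /
`re_expect_localPairAt_ge_of_minimiser` (p2, `TISourcedMinimiserChordFloorExact`).

No definition, no named fact, no `sorry`; zero compute. REUSED: p2's `hrows_of_clusterState`,
`hrowsTT'_of_clusterState`, `exists_canonicalClass_sourced_le_of_two_clusterCaps[TT']` (`TISourcedClusterTrialRows[TTPrime]`),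
pin-1's tiling (`Upper/DWaveSourceOpenClusterCap[TTPrime]`). References: D. Ruelle, *Statistical Mechanics: Rigorous
Results* (1969) §3.3–3.4 (periodic trial states, mixtures at fixed mean density).
-/

noncomputable section

namespace Summit.Ventures.CertifiedManyBodySolver.Observables

open Matrix Literature.Probability.LatticeModels
open Literature.MathematicalPhysics.QuantumLattice Literature.MathematicalPhysics.QuantumLattice.ThermodynamicLimit
open Literature.MathematicalPhysics.QuantumLattice.TwoCluster
open TorusRectBlock ClusterParity
open scoped ComplexOrder

/-! ### §0 The worst-end rule for an affine constraint -/

/-- An affine function of `x` that is `≤ 0` at both ends of `[lo, hi]` is `≤ 0` on the interval. -/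
theorem affine_nonpos_of_endpoints {s c x lo hi : ℝ} (hlo : lo ≤ x) (hhi : x ≤ hi)
    (h₁ : s * lo + c ≤ 0) (h₂ : s * hi + c ≤ 0) : s * x + c ≤ 0 := by
  by_cases hs : 0 ≤ s
  · have := mul_le_mul_of_nonneg_left hhi hs
    linarith
  · have := mul_le_mul_of_nonpos_left hlo (le_of_lt (not_le.1 hs))
    linarith

/-- The two-box mixing condition of `exists_canonicalClass_sourced_le_of_two_clusterCaps` is affine in the
lower density `n₁`: if it holds at `n₁ = nlo` and at `n₁ = nhi` it holds for every `n₁ ∈ [nlo, nhi]`. -/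
theorem twoCap_mixing_of_endpoints_lower {n₁ nlo nhi n₂ n μ₁ μ₂ u₁ u₂ u : ℝ} (hlo : nlo ≤ n₁) (hhi : n₁ ≤ nhi)
    (hulo : (n₂ - n) * (u₁ + μ₁ * nlo) + (n - nlo) * (u₂ + μ₂ * n₂) ≤ u * (n₂ - nlo))
    (huhi : (n₂ - n) * (u₁ + μ₁ * nhi) + (n - nhi) * (u₂ + μ₂ * n₂) ≤ u * (n₂ - nhi)) :
    (n₂ - n) * (u₁ + μ₁ * n₁) + (n - n₁) * (u₂ + μ₂ * n₂) ≤ u * (n₂ - n₁) := by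
  have key := affine_nonpos_of_endpoints (s := (n₂ - n) * μ₁ - (u₂ + μ₂ * n₂) + u)
    (c := (n₂ - n) * u₁ + n * (u₂ + μ₂ * n₂) - u * n₂) hlo hhi (by linarith) (by linarith)
  linarith

/-- The same condition is affine in the upper density `n₂`: end-point checks at `n₂ = nlo`, `n₂ = nhi` suffice
for every `n₂ ∈ [nlo, nhi]`. -/
theorem twoCap_mixing_of_endpoints_upper {n₁ nlo nhi n₂ n μ₁ μ₂ u₁ u₂ u : ℝ} (hlo : nlo ≤ n₂) (hhi : n₂ ≤ nhi)
    (hulo : (nlo - n) * (u₁ + μ₁ * n₁) + (n - n₁) * (u₂ + μ₂ * nlo) ≤ u * (nlo - n₁))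
    (huhi : (nhi - n) * (u₁ + μ₁ * n₁) + (n - n₁) * (u₂ + μ₂ * nhi) ≤ u * (nhi - n₁)) :
    (n₂ - n) * (u₁ + μ₁ * n₁) + (n - n₁) * (u₂ + μ₂ * n₂) ≤ u * (n₂ - n₁) := by
  have key := affine_nonpos_of_endpoints (s := (u₁ + μ₁ * n₁) + (n - n₁) * μ₂ - u)
    (c := -(n * (u₁ + μ₁ * n₁)) + (n - n₁) * u₂ + u * n₁) hlo hhi (by linarith) (by linarith)
  linarith

/-! ### §1 Producer side: periodic trial rows from a cluster node with an interval number row -/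

section Producer

variable {a b q L₀ : ℕ}

/-- **Interval-density periodic trial rows (`t′ = 0`).** An even unit vector of the open `a × b` box with
energy cap `≤ u·(ab)` at `(U, μ, h)` and number row in `[nlo·(ab), nhi·(ab)]` gives REAL slots `n ∈ [nlo, nhi]`,
`e ≤ u` and EXACT periodic trial rows for `dWaveSourceTorus L U μ h` on every torus `L ≥ L₀` with `q ∣ L`
(`a ∣ q`, `b ∣ q`, `a, b < L₀`): the `hrows` hypothesis of the TI bridge with a bracketed density. -/
theorem hrows_of_clusterNode_interval (ha : 0 < a) (hb : 0 < b) (hqa : a ∣ q) (hqb : b ∣ q) (hLa0 : a < L₀)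
    (hLb0 : b < L₀) (U μ h : ℝ) {nlo nhi u : ℝ}
    (hC : ∃ ψ : Fock (Orb (Fin a ×ₗ Fin b)), HasParity 0 ψ ∧ star ψ ⬝ᵥ ψ = 1 ∧
      (star ψ ⬝ᵥ (dWaveSourceOpenBox a b U μ h *ᵥ ψ)).re ≤ u * ((a : ℝ) * b) ∧
      nlo * ((a : ℝ) * b) ≤ (star ψ ⬝ᵥ (totalNumber *ᵥ ψ)).re ∧
      (star ψ ⬝ᵥ (totalNumber *ᵥ ψ)).re ≤ nhi * ((a : ℝ) * b)) :
    ∃ n e : ℝ, nlo ≤ n ∧ n ≤ nhi ∧ e ≤ u ∧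
      ∀ L : ℕ, q ∣ L → L₀ ≤ L → ∀ [NeZero L], ∃ Ψ : Fock (Orb (FermionTorus 2 L)),
        star Ψ ⬝ᵥ Ψ = 1 ∧ (expect totalNumber Ψ).re = n * (L : ℝ) ^ 2 ∧
          (expect (dWaveSourceTorus L U μ h) Ψ).re = e * (L : ℝ) ^ 2 := by
  obtain ⟨ψ, hψ, h1, hE, hNlo, hNhi⟩ := hC
  have hab : (0 : ℝ) < (a : ℝ) * b := by positivity
  refine ⟨(star ψ ⬝ᵥ (totalNumber *ᵥ ψ)).re / ((a : ℝ) * b),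
    (star ψ ⬝ᵥ (dWaveSourceOpenBox a b U μ h *ᵥ ψ)).re / ((a : ℝ) * b),
    (le_div_iff₀ hab).2 hNlo, (div_le_iff₀ hab).2 hNhi, (div_le_iff₀ hab).2 hE, ?_⟩
  exact hrows_of_clusterState hqa hqb hLa0 hLb0 U μ h hψ h1 (by field_simp) (by field_simp)

/-- **Interval-density periodic trial rows, general `tp`** (rows for `dWaveSourceTorusTT' L tp U μ h` from an
even unit vector of the open `t–t′` box `dWaveSourceOpenBoxTT' a b tp U μ h`). -/
theorem hrows_of_clusterNode_intervalTT' (ha : 0 < a) (hb : 0 < b) (hqa : a ∣ q) (hqb : b ∣ q)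
    (hLa0 : a < L₀) (hLb0 : b < L₀) (tp U μ h : ℝ) {nlo nhi u : ℝ}
    (hC : ∃ ψ : Fock (Orb (Fin a ×ₗ Fin b)), HasParity 0 ψ ∧ star ψ ⬝ᵥ ψ = 1 ∧
      (star ψ ⬝ᵥ (dWaveSourceOpenBoxTT' a b tp U μ h *ᵥ ψ)).re ≤ u * ((a : ℝ) * b) ∧
      nlo * ((a : ℝ) * b) ≤ (star ψ ⬝ᵥ (totalNumber *ᵥ ψ)).re ∧
      (star ψ ⬝ᵥ (totalNumber *ᵥ ψ)).re ≤ nhi * ((a : ℝ) * b)) :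
    ∃ n e : ℝ, nlo ≤ n ∧ n ≤ nhi ∧ e ≤ u ∧
      ∀ L : ℕ, q ∣ L → L₀ ≤ L → ∀ [NeZero L], ∃ Ψ : Fock (Orb (FermionTorus 2 L)),
        star Ψ ⬝ᵥ Ψ = 1 ∧ (expect totalNumber Ψ).re = n * (L : ℝ) ^ 2 ∧
          (expect (dWaveSourceTorusTT' L tp U μ h) Ψ).re = e * (L : ℝ) ^ 2 := by
  obtain ⟨ψ, hψ, h1, hE, hNlo, hNhi⟩ := hC
  have hab : (0 : ℝ) < (a : ℝ) * b := by positivity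
  refine ⟨(star ψ ⬝ᵥ (totalNumber *ᵥ ψ)).re / ((a : ℝ) * b),
    (star ψ ⬝ᵥ (dWaveSourceOpenBoxTT' a b tp U μ h *ᵥ ψ)).re / ((a : ℝ) * b),
    (le_div_iff₀ hab).2 hNlo, (div_le_iff₀ hab).2 hNhi, (div_le_iff₀ hab).2 hE, ?_⟩
  exact hrowsTT'_of_clusterState hqa hqb hLa0 hLb0 tp U μ h hψ h1 (by field_simp) (by field_simp)

/-- **Interval rows per torus** (`t′ = 0`): on every admissible torus there is a unit trial vector with
`nlo·L² ≤ Re⟨Ψ, NΨ⟩ ≤ nhi·L²` and `Re⟨Ψ, A_L(μ,h)Ψ⟩ ≤ u·L²` (the inequality shape, for consumers that do not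
need the common exact density). -/
theorem trialRows_interval_of_clusterNode (ha : 0 < a) (hb : 0 < b) (hqa : a ∣ q) (hqb : b ∣ q)
    (hLa0 : a < L₀) (hLb0 : b < L₀) (U μ h : ℝ) {nlo nhi u : ℝ}
    (hC : ∃ ψ : Fock (Orb (Fin a ×ₗ Fin b)), HasParity 0 ψ ∧ star ψ ⬝ᵥ ψ = 1 ∧
      (star ψ ⬝ᵥ (dWaveSourceOpenBox a b U μ h *ᵥ ψ)).re ≤ u * ((a : ℝ) * b) ∧
      nlo * ((a : ℝ) * b) ≤ (star ψ ⬝ᵥ (totalNumber *ᵥ ψ)).re ∧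
      (star ψ ⬝ᵥ (totalNumber *ᵥ ψ)).re ≤ nhi * ((a : ℝ) * b)) :
    ∀ L : ℕ, q ∣ L → L₀ ≤ L → ∀ [NeZero L], ∃ Ψ : Fock (Orb (FermionTorus 2 L)),
      star Ψ ⬝ᵥ Ψ = 1 ∧ nlo * (L : ℝ) ^ 2 ≤ (expect totalNumber Ψ).re ∧
        (expect totalNumber Ψ).re ≤ nhi * (L : ℝ) ^ 2 ∧
        (expect (dWaveSourceTorus L U μ h) Ψ).re ≤ u * (L : ℝ) ^ 2 := by
  obtain ⟨n, e, hnlo, hnhi, he, hrows⟩ := hrows_of_clusterNode_interval ha hb hqa hqb hLa0 hLb0 U μ h hC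
  intro L hqL hL _
  obtain ⟨Ψ, h1, hN, hE⟩ := hrows L hqL hL
  have hL2 : (0 : ℝ) ≤ (L : ℝ) ^ 2 := by positivity
  exact ⟨Ψ, h1, hN ▸ mul_le_mul_of_nonneg_right hnlo hL2, hN ▸ mul_le_mul_of_nonneg_right hnhi hL2,
    hE ▸ mul_le_mul_of_nonneg_right he hL2⟩

end Producer

/-! ### §2 The two-box canonical `hcap` with one interval partner -/

section TwoBoxes

variable {a₁ b₁ a₂ b₂ : ℕ}

/-- **Interval box BELOW the target density, exact box above (`t′ = 0`).** Box 1: even unit `ψ₁` of the open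
`a₁ × b₁` box with energy cap `u₁` at `μ₁` and number row in `[nlo, nhi]·(a₁b₁)`; box 2: even unit `ψ₂` of the
`a₂ × b₂` box with exact density `n₂` and cap `u₂` at `μ₂`; target density `nhi ≤ n < n₂`. If the mixing condition
`(n₂ − n)(u₁ + μ₁n₁) + (n − n₁)(u₂ + μ₂n₂) ≤ u(n₂ − n₁)` holds at BOTH end points `n₁ = nlo, nhi`, there is a
translation-invariant state of density exactly `n` with `μ = 0`-pencil sourced energy `≤ u` (the canonical `hcap`).
Worst-end rule: the condition is affine in the unknown exact density `n₁ ∈ [nlo, nhi]` of `ψ₁`. -/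
theorem exists_canonicalClass_sourced_le_of_clusterCapInterval_of_clusterCap (ha₁ : 0 < a₁) (hb₁ : 0 < b₁)
    (ha₂ : 0 < a₂) (hb₂ : 0 < b₂) (U μ₁ μ₂ h : ℝ)
    {ψ₁ : Fock (Orb (Fin a₁ ×ₗ Fin b₁))} (hψ₁ : HasParity 0 ψ₁) (h1₁ : star ψ₁ ⬝ᵥ ψ₁ = 1)
    {ψ₂ : Fock (Orb (Fin a₂ ×ₗ Fin b₂))} (hψ₂ : HasParity 0 ψ₂) (h1₂ : star ψ₂ ⬝ᵥ ψ₂ = 1)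
    {nlo nhi n₂ n u₁ u₂ u : ℝ}
    (hNlo : nlo * ((a₁ : ℝ) * b₁) ≤ (star ψ₁ ⬝ᵥ (totalNumber *ᵥ ψ₁)).re)
    (hNhi : (star ψ₁ ⬝ᵥ (totalNumber *ᵥ ψ₁)).re ≤ nhi * ((a₁ : ℝ) * b₁))
    (hE₁ : (star ψ₁ ⬝ᵥ (dWaveSourceOpenBox a₁ b₁ U μ₁ h *ᵥ ψ₁)).re ≤ u₁ * ((a₁ : ℝ) * b₁))
    (hN₂ : (star ψ₂ ⬝ᵥ (totalNumber *ᵥ ψ₂)).re = n₂ * ((a₂ : ℝ) * b₂))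
    (hE₂ : (star ψ₂ ⬝ᵥ (dWaveSourceOpenBox a₂ b₂ U μ₂ h *ᵥ ψ₂)).re ≤ u₂ * ((a₂ : ℝ) * b₂))
    (hhi : nhi ≤ n) (hlt : n < n₂)
    (hulo : (n₂ - n) * (u₁ + μ₁ * nlo) + (n - nlo) * (u₂ + μ₂ * n₂) ≤ u * (n₂ - nlo))
    (huhi : (n₂ - n) * (u₁ + μ₁ * nhi) + (n - nhi) * (u₂ + μ₂ * n₂) ≤ u * (n₂ - nhi)) :
    ∃ σ : InfVolFermionState 2, σ.IsTranslationInvariant ∧ σ.density = n ∧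
      σ.meanEnergy (hubbardTTPrimeSourcedInteraction 1 0 U 0 dWaveFormFactor h) 1 ≤ u := by
  have hab : (0 : ℝ) < (a₁ : ℝ) * b₁ := by positivity
  set n₁ : ℝ := (star ψ₁ ⬝ᵥ (totalNumber *ᵥ ψ₁)).re / ((a₁ : ℝ) * b₁) with hn₁
  have hN₁ : (star ψ₁ ⬝ᵥ (totalNumber *ᵥ ψ₁)).re = n₁ * ((a₁ : ℝ) * b₁) := by rw [hn₁]; field_simp
  have hlo₁ : nlo ≤ n₁ := (le_div_iff₀ hab).2 hNlo
  have hhi₁ : n₁ ≤ nhi := (div_le_iff₀ hab).2 hNhi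
  exact exists_canonicalClass_sourced_le_of_two_clusterCaps ha₁ hb₁ ha₂ hb₂ U μ₁ μ₂ h hψ₁ h1₁ hψ₂ h1₂ hN₁ hE₁
    hN₂ hE₂ (by linarith) (by linarith) hlt.le (twoCap_mixing_of_endpoints_lower hlo₁ hhi₁ hulo huhi)

/-- **Exact box below, interval box ABOVE the target density (`t′ = 0`)**: `n₁ < n ≤ nlo`, box 2's number row
in `[nlo, nhi]·(a₂b₂)`; end-point checks at `n₂ = nlo, nhi`. -/
theorem exists_canonicalClass_sourced_le_of_clusterCap_of_clusterCapInterval (ha₁ : 0 < a₁) (hb₁ : 0 < b₁)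
    (ha₂ : 0 < a₂) (hb₂ : 0 < b₂) (U μ₁ μ₂ h : ℝ)
    {ψ₁ : Fock (Orb (Fin a₁ ×ₗ Fin b₁))} (hψ₁ : HasParity 0 ψ₁) (h1₁ : star ψ₁ ⬝ᵥ ψ₁ = 1)
    {ψ₂ : Fock (Orb (Fin a₂ ×ₗ Fin b₂))} (hψ₂ : HasParity 0 ψ₂) (h1₂ : star ψ₂ ⬝ᵥ ψ₂ = 1)
    {n₁ nlo nhi n u₁ u₂ u : ℝ}
    (hN₁ : (star ψ₁ ⬝ᵥ (totalNumber *ᵥ ψ₁)).re = n₁ * ((a₁ : ℝ) * b₁))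
    (hE₁ : (star ψ₁ ⬝ᵥ (dWaveSourceOpenBox a₁ b₁ U μ₁ h *ᵥ ψ₁)).re ≤ u₁ * ((a₁ : ℝ) * b₁))
    (hNlo : nlo * ((a₂ : ℝ) * b₂) ≤ (star ψ₂ ⬝ᵥ (totalNumber *ᵥ ψ₂)).re)
    (hNhi : (star ψ₂ ⬝ᵥ (totalNumber *ᵥ ψ₂)).re ≤ nhi * ((a₂ : ℝ) * b₂))
    (hE₂ : (star ψ₂ ⬝ᵥ (dWaveSourceOpenBox a₂ b₂ U μ₂ h *ᵥ ψ₂)).re ≤ u₂ * ((a₂ : ℝ) * b₂))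
    (hlt : n₁ < n) (hlo : n ≤ nlo)
    (hulo : (nlo - n) * (u₁ + μ₁ * n₁) + (n - n₁) * (u₂ + μ₂ * nlo) ≤ u * (nlo - n₁))
    (huhi : (nhi - n) * (u₁ + μ₁ * n₁) + (n - n₁) * (u₂ + μ₂ * nhi) ≤ u * (nhi - n₁)) :
    ∃ σ : InfVolFermionState 2, σ.IsTranslationInvariant ∧ σ.density = n ∧
      σ.meanEnergy (hubbardTTPrimeSourcedInteraction 1 0 U 0 dWaveFormFactor h) 1 ≤ u := by
  have hab : (0 : ℝ) < (a₂ : ℝ) * b₂ := by positivity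
  set n₂ : ℝ := (star ψ₂ ⬝ᵥ (totalNumber *ᵥ ψ₂)).re / ((a₂ : ℝ) * b₂) with hn₂
  have hN₂ : (star ψ₂ ⬝ᵥ (totalNumber *ᵥ ψ₂)).re = n₂ * ((a₂ : ℝ) * b₂) := by rw [hn₂]; field_simp
  have hlo₂ : nlo ≤ n₂ := (le_div_iff₀ hab).2 hNlo
  have hhi₂ : n₂ ≤ nhi := (div_le_iff₀ hab).2 hNhi
  exact exists_canonicalClass_sourced_le_of_two_clusterCaps ha₁ hb₁ ha₂ hb₂ U μ₁ μ₂ h hψ₁ h1₁ hψ₂ h1₂ hN₁ hE₁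
    hN₂ hE₂ (by linarith) hlt.le (by linarith) (twoCap_mixing_of_endpoints_upper hlo₂ hhi₂ hulo huhi)

/-- **Interval box below, exact box above, general `tp`** (boxes `dWaveSourceOpenBoxTT' aᵢ bᵢ tp U μᵢ h`; conclusion
for the `t–t′` interaction `hubbardTTPrimeSourcedInteraction 1 tp U 0 dWaveFormFactor h`). -/
theorem exists_canonicalClass_sourced_le_of_clusterCapInterval_of_clusterCapTT' (ha₁ : 0 < a₁) (hb₁ : 0 < b₁)
    (ha₂ : 0 < a₂) (hb₂ : 0 < b₂) (tp U μ₁ μ₂ h : ℝ)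
    {ψ₁ : Fock (Orb (Fin a₁ ×ₗ Fin b₁))} (hψ₁ : HasParity 0 ψ₁) (h1₁ : star ψ₁ ⬝ᵥ ψ₁ = 1)
    {ψ₂ : Fock (Orb (Fin a₂ ×ₗ Fin b₂))} (hψ₂ : HasParity 0 ψ₂) (h1₂ : star ψ₂ ⬝ᵥ ψ₂ = 1)
    {nlo nhi n₂ n u₁ u₂ u : ℝ}
    (hNlo : nlo * ((a₁ : ℝ) * b₁) ≤ (star ψ₁ ⬝ᵥ (totalNumber *ᵥ ψ₁)).re)
    (hNhi : (star ψ₁ ⬝ᵥ (totalNumber *ᵥ ψ₁)).re ≤ nhi * ((a₁ : ℝ) * b₁))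
    (hE₁ : (star ψ₁ ⬝ᵥ (dWaveSourceOpenBoxTT' a₁ b₁ tp U μ₁ h *ᵥ ψ₁)).re ≤ u₁ * ((a₁ : ℝ) * b₁))
    (hN₂ : (star ψ₂ ⬝ᵥ (totalNumber *ᵥ ψ₂)).re = n₂ * ((a₂ : ℝ) * b₂))
    (hE₂ : (star ψ₂ ⬝ᵥ (dWaveSourceOpenBoxTT' a₂ b₂ tp U μ₂ h *ᵥ ψ₂)).re ≤ u₂ * ((a₂ : ℝ) * b₂))
    (hhi : nhi ≤ n) (hlt : n < n₂)
    (hulo : (n₂ - n) * (u₁ + μ₁ * nlo) + (n - nlo) * (u₂ + μ₂ * n₂) ≤ u * (n₂ - nlo))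
    (huhi : (n₂ - n) * (u₁ + μ₁ * nhi) + (n - nhi) * (u₂ + μ₂ * n₂) ≤ u * (n₂ - nhi)) :
    ∃ σ : InfVolFermionState 2, σ.IsTranslationInvariant ∧ σ.density = n ∧
      σ.meanEnergy (hubbardTTPrimeSourcedInteraction 1 tp U 0 dWaveFormFactor h) 1 ≤ u := by
  have hab : (0 : ℝ) < (a₁ : ℝ) * b₁ := by positivity
  set n₁ : ℝ := (star ψ₁ ⬝ᵥ (totalNumber *ᵥ ψ₁)).re / ((a₁ : ℝ) * b₁) with hn₁
  have hN₁ : (star ψ₁ ⬝ᵥ (totalNumber *ᵥ ψ₁)).re = n₁ * ((a₁ : ℝ) * b₁) := by rw [hn₁]; field_simp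
  have hlo₁ : nlo ≤ n₁ := (le_div_iff₀ hab).2 hNlo
  have hhi₁ : n₁ ≤ nhi := (div_le_iff₀ hab).2 hNhi
  exact exists_canonicalClass_sourced_le_of_two_clusterCapsTT' ha₁ hb₁ ha₂ hb₂ tp U μ₁ μ₂ h hψ₁ h1₁ hψ₂ h1₂
    hN₁ hE₁ hN₂ hE₂ (by linarith) (by linarith) hlt.le (twoCap_mixing_of_endpoints_lower hlo₁ hhi₁ hulo huhi)

/-- **Exact box below, interval box above, general `tp`.** -/
theorem exists_canonicalClass_sourced_le_of_clusterCap_of_clusterCapIntervalTT' (ha₁ : 0 < a₁) (hb₁ : 0 < b₁)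
    (ha₂ : 0 < a₂) (hb₂ : 0 < b₂) (tp U μ₁ μ₂ h : ℝ)
    {ψ₁ : Fock (Orb (Fin a₁ ×ₗ Fin b₁))} (hψ₁ : HasParity 0 ψ₁) (h1₁ : star ψ₁ ⬝ᵥ ψ₁ = 1)
    {ψ₂ : Fock (Orb (Fin a₂ ×ₗ Fin b₂))} (hψ₂ : HasParity 0 ψ₂) (h1₂ : star ψ₂ ⬝ᵥ ψ₂ = 1)
    {n₁ nlo nhi n u₁ u₂ u : ℝ}
    (hN₁ : (star ψ₁ ⬝ᵥ (totalNumber *ᵥ ψ₁)).re = n₁ * ((a₁ : ℝ) * b₁))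
    (hE₁ : (star ψ₁ ⬝ᵥ (dWaveSourceOpenBoxTT' a₁ b₁ tp U μ₁ h *ᵥ ψ₁)).re ≤ u₁ * ((a₁ : ℝ) * b₁))
    (hNlo : nlo * ((a₂ : ℝ) * b₂) ≤ (star ψ₂ ⬝ᵥ (totalNumber *ᵥ ψ₂)).re)
    (hNhi : (star ψ₂ ⬝ᵥ (totalNumber *ᵥ ψ₂)).re ≤ nhi * ((a₂ : ℝ) * b₂))
    (hE₂ : (star ψ₂ ⬝ᵥ (dWaveSourceOpenBoxTT' a₂ b₂ tp U μ₂ h *ᵥ ψ₂)).re ≤ u₂ * ((a₂ : ℝ) * b₂))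
    (hlt : n₁ < n) (hlo : n ≤ nlo)
    (hulo : (nlo - n) * (u₁ + μ₁ * n₁) + (n - n₁) * (u₂ + μ₂ * nlo) ≤ u * (nlo - n₁))
    (huhi : (nhi - n) * (u₁ + μ₁ * n₁) + (n - n₁) * (u₂ + μ₂ * nhi) ≤ u * (nhi - n₁)) :
    ∃ σ : InfVolFermionState 2, σ.IsTranslationInvariant ∧ σ.density = n ∧
      σ.meanEnergy (hubbardTTPrimeSourcedInteraction 1 tp U 0 dWaveFormFactor h) 1 ≤ u := by
  have hab : (0 : ℝ) < (a₂ : ℝ) * b₂ := by positivity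
  set n₂ : ℝ := (star ψ₂ ⬝ᵥ (totalNumber *ᵥ ψ₂)).re / ((a₂ : ℝ) * b₂) with hn₂
  have hN₂ : (star ψ₂ ⬝ᵥ (totalNumber *ᵥ ψ₂)).re = n₂ * ((a₂ : ℝ) * b₂) := by rw [hn₂]; field_simp
  have hlo₂ : nlo ≤ n₂ := (le_div_iff₀ hab).2 hNlo
  have hhi₂ : n₂ ≤ nhi := (div_le_iff₀ hab).2 hNhi
  exact exists_canonicalClass_sourced_le_of_two_clusterCapsTT' ha₁ hb₁ ha₂ hb₂ tp U μ₁ μ₂ h hψ₁ h1₁ hψ₂ h1₂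
    hN₁ hE₁ hN₂ hE₂ (by linarith) hlt.le (by linarith) (twoCap_mixing_of_endpoints_upper hlo₂ hhi₂ hulo huhi)

/-- **Node shape (`t′ = 0`), both certificates existential** — the form in which a `Certificates/` claim node is
consumed BY NAME (box 1 in the var-10 conjunct order `parity ∧ unit ∧ energy ≤ ∧ nlo ≤ N ∧ N ≤ nhi`, box 2 in the
pin-1 order `parity ∧ unit ∧ N = n₂·(ab) ∧ energy ≤ u₂·(ab)`). -/
theorem exists_canonicalClass_sourced_le_of_clusterNodeInterval_of_clusterNode (ha₁ : 0 < a₁) (hb₁ : 0 < b₁)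
    (ha₂ : 0 < a₂) (hb₂ : 0 < b₂) (U μ₁ μ₂ h : ℝ) {nlo nhi n₂ n u₁ u₂ u : ℝ}
    (hC₁ : ∃ ψ : Fock (Orb (Fin a₁ ×ₗ Fin b₁)), HasParity 0 ψ ∧ star ψ ⬝ᵥ ψ = 1 ∧
      (star ψ ⬝ᵥ (dWaveSourceOpenBox a₁ b₁ U μ₁ h *ᵥ ψ)).re ≤ u₁ * ((a₁ : ℝ) * b₁) ∧
      nlo * ((a₁ : ℝ) * b₁) ≤ (star ψ ⬝ᵥ (totalNumber *ᵥ ψ)).re ∧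
      (star ψ ⬝ᵥ (totalNumber *ᵥ ψ)).re ≤ nhi * ((a₁ : ℝ) * b₁))
    (hC₂ : ∃ ψ : Fock (Orb (Fin a₂ ×ₗ Fin b₂)), HasParity 0 ψ ∧ star ψ ⬝ᵥ ψ = 1 ∧
      (star ψ ⬝ᵥ (totalNumber *ᵥ ψ)).re = n₂ * ((a₂ : ℝ) * b₂) ∧
      (star ψ ⬝ᵥ (dWaveSourceOpenBox a₂ b₂ U μ₂ h *ᵥ ψ)).re ≤ u₂ * ((a₂ : ℝ) * b₂))
    (hhi : nhi ≤ n) (hlt : n < n₂)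
    (hulo : (n₂ - n) * (u₁ + μ₁ * nlo) + (n - nlo) * (u₂ + μ₂ * n₂) ≤ u * (n₂ - nlo))
    (huhi : (n₂ - n) * (u₁ + μ₁ * nhi) + (n - nhi) * (u₂ + μ₂ * n₂) ≤ u * (n₂ - nhi)) :
    ∃ σ : InfVolFermionState 2, σ.IsTranslationInvariant ∧ σ.density = n ∧
      σ.meanEnergy (hubbardTTPrimeSourcedInteraction 1 0 U 0 dWaveFormFactor h) 1 ≤ u := by
  obtain ⟨ψ₁, hψ₁, h1₁, hE₁, hNlo, hNhi⟩ := hC₁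
  obtain ⟨ψ₂, hψ₂, h1₂, hN₂, hE₂⟩ := hC₂
  exact exists_canonicalClass_sourced_le_of_clusterCapInterval_of_clusterCap ha₁ hb₁ ha₂ hb₂ U μ₁ μ₂ h hψ₁ h1₁
    hψ₂ h1₂ hNlo hNhi hE₁ hN₂ hE₂ hhi hlt hulo huhi

end TwoBoxes

end Summit.Ventures.CertifiedManyBodySolver.Observables

end
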